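import Summits.FinalStateConjecture.FinalStateConjecture.Theorems.ZeroEnergyKerrOrBombStationaryLimitReductionStubMoncriefTransversality
import Summits.FinalStateConjecture.FinalStateConjecture.Theorems.ZeroEnergyKerrOrBombStationaryLimitReductionStubDualModeEjection
import Literature.Geometry.Lorentzian.AdmissibleDataLocality
import HarnessLib

/-!
# Route ZeroEnergyKerrOrBomb · crux `StationaryLimitReduction`, line `symplectic-dual-of-the-bomb`
# (reshape r3): stub `stub_moncriefFacts` — junk/soundness AUDIT of the two cited local facts
# `LocalConstraintDeformationAt`, `LocalMoncriefDualityAt` (p105738), with kernel certificates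

Stub 4 of reshape r3, `stub_moncriefFacts : Sig.stub_moncriefFacts` (crux stmt-FinalStateConjecture-10021;
the statement is the conjunction of the universal closures `∀ X D 𝒟 x₀` of the two `Prop`s of
`…StationaryLimitReductionStubMoncriefTransversality.lean`, §3), registers the two printed inputs of
the lever; the corrected Moncrief transversality is DERIVED from them in the tree
(`stub_moncriefTransversality_of_localDeformation`). Neither fact is provable in this tree (no
elliptic theory for the KID operator `DΦ*`, no Banach inverse function theorem into `C^∞`, no Killing
development of KIDs), so the stub is BLOCKED; this file records what IS decidable — that both
predicates are honest (neither junk-true nor junk-false for typing reasons) — as kernel-checked lemmas: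

* §1 the interface `IsLinearisedSolutionIn D a b K` is honest: `(0, 0)` is a linearised solution on
  every `K` (`isLinearisedSolutionIn_zero`); the tangent `(a, b)` of ANY witness family is symmetric
  (`isLinearisedSolutionIn_symm`) and vanishes identically off `K` (`isLinearisedSolutionIn_eq_zero_off`)
  — `famTangentH/K` are fibrewise `deriv`s, junk `0` only where a fibre curve is not differentiable, so
  a "wild" `a` can never be certified; classically the fibre curves of a jointly smooth family are smooth.
* §2 fact (a) `LocalConstraintDeformationAt`: its admissibility clause `∀ c, G c ∈ admissibleVacuumData X`
  is FREE given the vacuum constraints (`localConstraintDeformationAt_of_vacuum`, by the tree's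
  `mem_admissibleVacuumData_of_agree_off_compact`), so (a) is exactly the local statement of
  Corvino–Schoen (gr-qc/0301071 = J. Differential Geom. 73 (2006) 185, Thm. 2, §4: local surjectivity of
  the constraint map with corrections supported in `Ω̄`, no KIDs on `Ω`, smooth data/exponential weight ⇒
  smooth solutions) and Chruściel–Delay (gr-qc/0301073 = Mém. SMF 94 (2003), Thm. 5.9, Prop. 5.10,
  Cor. 5.11: compact manifold with boundary, exponentially weighted spaces, solutions extend smoothly by
  zero across `∂Ω`; gr-qc/0309001 = J. Geom. Phys. 51 (2004) 442, Prop. 2.3 and Thm. 6.6: the KID-free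
  solutions form an embedded submanifold with tangent space `ker DΦ`), plus Moncrief's KIDs ↔ Killing
  fields (J. Math. Phys. 16 (1975) 493, §III) to turn `IsKIDFreeAt` into "no KIDs on small balls", plus
  the squash reparametrisation. Inputs supported in `K = ∅` are exponentiated by the constant family
  (`localConstraintDeformation_empty_support`), and the guards make (a) vacuous off admissible KID-free
  germs (`localConstraintDeformationAt_of_not`) — the closure `∀ D 𝒟 x₀` in `Sig` is harmless. NOT
  junk-true: every open `U ∋ x₀` carries non-trivial compactly supported linearised solutions (pull-backs
  of `D` by compactly supported diffeomorphisms: exact vacuum families with tangent `(𝓛_Y h, 𝓛_Y k)`;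
  and Delay, Comm. PDE 37 (2012) 1689 = arXiv:1003.0535, Thms. 1.3 and 1.5: kernel elements of such underdetermined
  elliptic operators can be truncated to compact support, so `ker DΦ ∩ C_c^∞(U)` is infinite-dimensional modulo gauge).
* §3 fact (b) `LocalMoncriefDualityAt`: `k = 0` holds outright (`localMoncriefDuality_fin_zero`); zero
  detectors, whose pairing column vanishes identically (`chartPairing_zero_detectors`), ARE local slice
  tangents (`isLocalSliceTangentAt_zero`: the constant deformation `ι_s = ι`) and hence excluded by the
  non-gauge hypothesis (`not_areDetectorsAt_zero`) — the hypothesis has content and the obvious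
  degenerate instance is not a counterexample. The `omegaDensity` of the Defs module was re-derived by
  hand from `π^{ij} = √h (k^{ij} − K h^{ij})` (it is the ADM form; gauge pairs annihilate compactly
  supported linearised solutions, Moncrief, J. Math. Phys. 16 (1975) 493, §II). In print only GLOBALLY (compact `Σ`):
  Moncrief, *Decompositions of gravitational perturbations*, J. Math. Phys. 16 (1975) 1556 (the `L²` splitting
  `ker DΦ ∩ ker DΦ∘J ⊕ ran J∘DΦ* ⊕ ran DΦ*`); Fischer–Marsden–Moncrief, Ann. IHP A 33 (1980) 147, §1–2;
  Arms–Marsden–Moncrief, Ann. Phys. 144 (1982) 81. The LOCAL dual statement (annihilator of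
  `ker DΦ ∩ C_c^∞(U)` = local gauge `J∘DΦ*(N, Y)`) follows from Chruściel–Delay's closed range on
  weighted spaces over balls (2003, Thm. 3.6/5.9) by the closed-range theorem and interior elliptic
  regularity of the overdetermined KID operator, with or WITHOUT KIDs near `x₀` (hence no KID hypothesis
  in (b)) — routine, but not printed as such: "printed modulo localisation".
* §4 consistency: the conjunction `Sig.stub_moncriefFacts` (spelled verbatim) yields the CORRECTED
  transversality for symmetric detectors at a germ-KID-free point
  (`moncriefTransversality_of_moncriefFacts` = the skeleton's `moncriefTransversality_of_facts`), and
  it can NOT re-derive the refuted r1 text: any derivation of the r1 text from the facts refutes the facts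
  as soon as one admissible datum has one weakly Killing-free point (`moncriefFacts_false_of_imp_r1`,
  from `moncriefTransversality_false_of_kidFreePoint`, p104819).

Verdict reported to the lead: `stub-blocked: NONE-EXISTS` (both facts true on paper; (a) printed up
to assembly, (b) printed only globally). No new definitions, no axioms, no `sorry`.
-/

-- every `Summit.FinalStateConjecture.FinalStateConjecture.…` name repeats the summit = sub-problem segment (D-0017 layout)
set_option linter.dupNamespace false
set_option maxSynthPendingDepth 3

noncomputable section

open scoped Manifold ContDiff Topology BigOperators
open Set Filter Bundle MeasureTheory Literature.Geometry.Lorentzian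

namespace Summit.FinalStateConjecture.FinalStateConjecture.Theorems.SymplecticDualOfTheBomb

open Summit.FinalStateConjecture.FinalStateConjecture.Theorems.OneLockedExplosion

/-! ## §1 The interface `IsLinearisedSolutionIn` is honest -/

/-- The tangents of a constant family vanish (metric part). [folklore] -/
private theorem famTangentH_const {X : Type} [TopologicalSpace X] [ChartedSpace E3 X]
    [IsManifold (𝓡 3) ∞ X] {k : ℕ} (D : InitialDataSet (𝓡 3) X) (j : Fin k) :
    famTangentH (fun _ : EuclideanSpace ℝ (Fin k) ↦ D) j = 0 := by
  funext x
  show deriv (fun _ : ℝ ↦ (show E3 →L[ℝ] E3 →L[ℝ] ℝ from D.h.inner x)) 0 = 0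
  exact deriv_const _ _

/-- The tangents of a constant family vanish (`k` part). [folklore] -/
private theorem famTangentK_const {X : Type} [TopologicalSpace X] [ChartedSpace E3 X]
    [IsManifold (𝓡 3) ∞ X] {k : ℕ} (D : InitialDataSet (𝓡 3) X) (j : Fin k) :
    famTangentK (fun _ : EuclideanSpace ℝ (Fin k) ↦ D) j = 0 := by
  funext x
  show deriv (fun _ : ℝ ↦ (show E3 →L[ℝ] E3 →L[ℝ] ℝ from D.k x)) 0 = 0
  exact deriv_const _ _

/-- **`(0, 0)` is a linearised solution supported in any `K`** (witness: the constant family; all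
fibre curves and both constraint functions are constant in the parameter). [folklore] -/
theorem isLinearisedSolutionIn_zero : ∀ (X : Type) [TopologicalSpace X] [ChartedSpace E3 X] [IsManifold (𝓡 3) ∞ X] (D : InitialDataSet (𝓡 3) X) (K : Set X), IsLinearisedSolutionIn D 0 0 K := by
  intro X _ _ _ D K
  refine ⟨fun _ ↦ D, InitialDataSet.isSmoothDataFamily_const 1 D, rfl, fun _ _ _ ↦ ⟨rfl, rfl⟩,
    famTangentH_const D 0, famTangentK_const D 0, fun x ↦ ⟨?_, fun v ↦ ?_⟩⟩
  · beta_reduce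
    exact hasDerivAt_const (0 : ℝ) (haveI := D.metric.hasLeviCivita; D.hamiltonianConstraintFn x)
  · beta_reduce
    exact hasDerivAt_const (0 : ℝ) (haveI := D.metric.hasLeviCivita; D.momentumConstraintFn x v)

/-- **The tangent of a witness family vanishes off its support**: if `IsLinearisedSolutionIn D a b K`
then `a x = 0` and `b x = 0` for every `x ∉ K` (the fibre curves at `x` are constant). [folklore] -/
theorem isLinearisedSolutionIn_eq_zero_off : ∀ (X : Type) [TopologicalSpace X] [ChartedSpace E3 X] [IsManifold (𝓡 3) ∞ X] (D : InitialDataSet (𝓡 3) X) (a b : BilinField X) (K : Set X), IsLinearisedSolutionIn D a b K → ∀ x ∉ K, a x = 0 ∧ b x = 0 := by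
  intro X _ _ _ D a b K h x hx
  obtain ⟨F, -, -, hsupp, ha, hb, -⟩ := h
  subst ha hb
  constructor
  · show deriv (fun s : ℝ ↦ (show E3 →L[ℝ] E3 →L[ℝ] ℝ from
      (F (EuclideanSpace.single 0 s)).h.inner x)) 0 = 0
    have key : (fun s : ℝ ↦ (show E3 →L[ℝ] E3 →L[ℝ] ℝ from
        (F (EuclideanSpace.single 0 s)).h.inner x)) =
        fun _ ↦ (show E3 →L[ℝ] E3 →L[ℝ] ℝ from D.h.inner x) :=
      funext fun s ↦ (hsupp _ x hx).1
    rw [key, deriv_const]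
  · show deriv (fun s : ℝ ↦ (show E3 →L[ℝ] E3 →L[ℝ] ℝ from
      (F (EuclideanSpace.single 0 s)).k x)) 0 = 0
    have key : (fun s : ℝ ↦ (show E3 →L[ℝ] E3 →L[ℝ] ℝ from (F (EuclideanSpace.single 0 s)).k x)) =
        fun _ ↦ (show E3 →L[ℝ] E3 →L[ℝ] ℝ from D.k x) :=
      funext fun s ↦ (hsupp _ x hx).2
    rw [key, deriv_const]

/-- **The tangent of a witness family is a pair of SYMMETRIC forms** (derivatives of curves of
symmetric forms, junk value included; `famTangentH_symm`/`famTangentK_symm` of p104819). [folklore] -/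
theorem isLinearisedSolutionIn_symm : ∀ (X : Type) [TopologicalSpace X] [ChartedSpace E3 X] [IsManifold (𝓡 3) ∞ X] (D : InitialDataSet (𝓡 3) X) (a b : BilinField X) (K : Set X), IsLinearisedSolutionIn D a b K → ∀ (x : X) (v w : TangentSpace (𝓡 3) x), a x v w = a x w v ∧ b x v w = b x w v := by
  intro X _ _ _ D a b K h x v w
  obtain ⟨F, -, -, -, ha, hb, -⟩ := h
  subst ha hb
  exact ⟨famTangentH_symm X 1 F 0 x v w, famTangentK_symm X 1 F 0 x v w⟩

/-! ## §2 Fact (a) `LocalConstraintDeformationAt`: admissibility is free, guards, empty support -/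

/-- **The admissibility clause of fact (a) is free**: it suffices to produce families of VACUUM data
(vacuum constraints for every parameter), the remaining admissibility clauses (completeness, the sole
strongly asymptotically flat end) pass from `D` to every datum agreeing with `D` off the compact `K'`
(`mem_admissibleVacuumData_of_agree_off_compact`). Hence (a) is exactly the local deformation
theorem of Corvino–Schoen (gr-qc/0301071, Thm. 2) / Chruściel–Delay (Mém. SMF 94, Thm. 5.9–Cor. 5.11;
J. Geom. Phys. 51 (2004), Thm. 6.6). [cite: Christodoulou1999, p. A24] -/
theorem localConstraintDeformationAt_of_vacuum : ∀ (X : Type) [TopologicalSpace X] [ChartedSpace E3 X] [IsManifold (𝓡 3) ∞ X] [T2Space X] [SecondCountableTopology X] [ConnectedSpace X] (D : InitialDataSet (𝓡 3) X) (𝒟 : VacuumCauchyDevelopment D) (x₀ : X), (D ∈ admissibleVacuumData X → IsKIDFreeAt 𝒟 x₀ → ∀ V : Set X, IsOpen V → x₀ ∈ V → ∃ U : Set X, IsOpen U ∧ x₀ ∈ U ∧ U ⊆ V ∧ ∀ (k : ℕ) (a b : Fin k → BilinField X) (K : Set X), IsCompact K → K ⊆ U → (∀ j, IsLinearisedSolutionIn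 D (a j) (b j) K) → ∃ (G : EuclideanSpace ℝ (Fin k) → InitialDataSet (𝓡 3) X) (ε : ℝ), ε ≠ 0 ∧ InitialDataSet.IsSmoothDataFamily k G ∧ G 0 = D ∧ (∀ c, ∀ [(G c).metric.HasLeviCivita], (G c).IsVacuumConstraintSolution) ∧ (∃ K' : Set X, IsCompact K' ∧ K' ⊆ V ∧ IsSupportedIn D G K') ∧ ∀ j, famTangentH G j = ε • a j ∧ famTangentK G j = ε • b j) → LocalConstraintDeformationAt 𝒟 x₀ := by
  intro X _ _ _ _ _ _ D 𝒟 x₀ h hD hKID V hV hxV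
  obtain ⟨U, hU, hxU, hUV, hdom⟩ := h hD hKID V hV hxV
  refine ⟨U, hU, hxU, hUV, fun k a b K hKc hKU hlin ↦ ?_⟩
  obtain ⟨G, ε, hε, hG, hG0, hvac, ⟨K', hK'c, hK'V, hsupp⟩, htan⟩ := hdom k a b K hKc hKU hlin
  refine ⟨G, ε, hε, hG, hG0, fun c ↦ ?_, ⟨K', hK'c, hK'V, hsupp⟩, htan⟩
  exact InitialDataSet.mem_admissibleVacuumData_of_agree_off_compact hD (hvac c) hK'c
    fun x hx ↦ hsupp c x hx

/-- **Guards**: fact (a) is vacuous (hence holds) at a non-admissible datum or at a point carrying a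
local Killing germ — the universal closure `∀ X D 𝒟 x₀` in `Sig.stub_moncriefFacts` only bites on
admissible KID-free germs. [folklore] -/
theorem localConstraintDeformationAt_of_not : ∀ (X : Type) [TopologicalSpace X] [ChartedSpace E3 X] [IsManifold (𝓡 3) ∞ X] [T2Space X] [SecondCountableTopology X] [ConnectedSpace X] (D : InitialDataSet (𝓡 3) X) (𝒟 : VacuumCauchyDevelopment D) (x₀ : X), (D ∉ admissibleVacuumData X ∨ ¬ IsKIDFreeAt 𝒟 x₀) → LocalConstraintDeformationAt 𝒟 x₀ :=
  fun _ _ _ _ _ _ _ _ _ _ h hD hKID ↦ h.elim (fun h ↦ absurd hD h) fun h ↦ absurd hKID h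

/-- **Inputs supported in `K = ∅` are no obstruction to fact (a)**: their tangents vanish
(`isLinearisedSolutionIn_eq_zero_off`), and the constant family through the admissible `D`
(`ε = 1`, `K' = ∅`) exponentiates them. A typing certificate of every clause of the conclusion of
(a). [folklore] -/
theorem localConstraintDeformation_empty_support : ∀ (X : Type) [TopologicalSpace X] [ChartedSpace E3 X] [IsManifold (𝓡 3) ∞ X], ∀ D ∈ admissibleVacuumData X, ∀ (V : Set X) (k : ℕ) (a b : Fin k → BilinField X), (∀ j, IsLinearisedSolutionIn D (a j) (b j) ∅) → ∃ (G : EuclideanSpace ℝ (Fin k) → InitialDataSet (𝓡 3) X) (ε : ℝ), ε ≠ 0 ∧ InitialDataSet.IsSmoothDataFamily k G ∧ G 0 = D ∧ (∀ c, G c ∈ admissibleVacuumData X) ∧ (∃ K' : Set X, IsCompact K' ∧ K' ⊆ V ∧ IsSupportedIn D G K') ∧ ∀ j, famTangentH G j = ε • a j ∧ famTangentK G j = ε • b j := by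
  intro X _ _ _ D hD V k a b hlin
  have hab : ∀ j, a j = 0 ∧ b j = 0 := fun j ↦
    ⟨funext fun x ↦ (isLinearisedSolutionIn_eq_zero_off X D (a j) (b j) ∅ (hlin j) x
        (Set.notMem_empty x)).1,
      funext fun x ↦ (isLinearisedSolutionIn_eq_zero_off X D (a j) (b j) ∅ (hlin j) x
        (Set.notMem_empty x)).2⟩
  refine ⟨fun _ ↦ D, 1, one_ne_zero, InitialDataSet.isSmoothDataFamily_const k D, rfl, fun _ ↦ hD,
    ⟨∅, isCompact_empty, Set.empty_subset _, fun _ _ _ ↦ ⟨rfl, rfl⟩⟩, fun j ↦ ⟨?_, ?_⟩⟩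
  · simp only [famTangentH_const, (hab j).1, smul_zero]
  · simp only [famTangentK_const, (hab j).2, smul_zero]

/-! ## §3 Fact (b) `LocalMoncriefDualityAt`: `k = 0`, zero detectors are gauge and excluded -/

/-- **Fact (b) for `k = 0` detectors holds outright** (the quantifier-free instance of its body):
`a = b =` the empty tuple, `K = ∅`, and the `0 × 0` pairing matrix has determinant `1`. [folklore] -/
theorem localMoncriefDuality_fin_zero : ∀ (X : Type) [TopologicalSpace X] [ChartedSpace E3 X] [IsManifold (𝓡 3) ∞ X] (D : InitialDataSet (𝓡 3) X) (x₀ : X) (A B : Fin 0 → BilinField X) (U : Set X), ∃ (a b : Fin 0 → BilinField X) (K : Set X), IsCompact K ∧ K ⊆ U ∧ (∀ j, IsLinearisedSolutionIn D (a j) (b j) K) ∧ (Matrix.of fun j l ↦ chartPairing D x₀ (A l) (B l) (a j) (b j)).det ≠ 0 := by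
  intro X _ _ _ D x₀ A B U
  refine ⟨fun j ↦ j.elim0, fun j ↦ j.elim0, ∅, isCompact_empty, Set.empty_subset _,
    fun j ↦ j.elim0, ?_⟩
  rw [Matrix.det_isEmpty]
  exact one_ne_zero

/-- **Zero detectors pair to zero with every kick**: `ω((0, 0), (a, b)) = 0` read in any chart (the
density is linear in the detector). So for the zero detector no family can have a non-singular
pairing matrix — and indeed it is excluded by the non-gauge hypothesis (`not_areDetectorsAt_zero`). [folklore] -/
theorem chartPairing_zero_detectors : ∀ (X : Type) [TopologicalSpace X] [ChartedSpace E3 X] [IsManifold (𝓡 3) ∞ X] (D : InitialDataSet (𝓡 3) X) (x₀ : X) (a b : BilinField X), chartPairing D x₀ 0 0 a b = 0 := by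
  intro X _ _ _ D x₀ a b
  have h1 : ∀ (x : X) (T : TangentSpace (𝓡 3) x →L[ℝ] TangentSpace (𝓡 3) x →L[ℝ] ℝ),
      symInner D x 0 T = 0 := fun x T ↦ by
    simpa using symInner_smul_left D x 0 0 T
  have h2 : ∀ (x : X) (S : TangentSpace (𝓡 3) x →L[ℝ] TangentSpace (𝓡 3) x →L[ℝ] ℝ),
      symInner D x S 0 = 0 := fun x S ↦ by
    simpa using symInner_smul_right D x 0 S 0
  have h3 : ∀ x : X, hTrace D x 0 = 0 := fun x ↦ by
    simpa using hTrace_smul D x 0 0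
  have h : ∀ x, omegaDensity D 0 0 a b x = 0 := fun x ↦ by
    simp only [omegaDensity, Pi.zero_apply, h1, h2, h3]
    ring
  unfold chartPairing
  simp [h]

/-- **The zero pair `(0, 0)` IS a local slice tangent at every point**: the constant deformation
`ι_s := ι` with the development's own future unit normals has vanishing first variation of both the
induced metric and the second fundamental form. [folklore] -/
theorem isLocalSliceTangentAt_zero : ∀ (X : Type) [TopologicalSpace X] [ChartedSpace E3 X] [IsManifold (𝓡 3) ∞ X] [T2Space X] [SecondCountableTopology X] [ConnectedSpace X] (D : InitialDataSet (𝓡 3) X) (𝒟 : VacuumCauchyDevelopment D) (x₀ : X), IsLocalSliceTangentAt 𝒟 0 0 x₀ := by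
  intro X _ _ _ _ _ _ D 𝒟 x₀
  refine ⟨Set.univ, 1, isOpen_univ, Set.mem_univ _, one_pos, fun _ ↦ 𝒟.embed, fun _ ↦ 𝒟.normal,
    rfl, ?_, ?_, ?_⟩
  · exact (𝒟.isSmoothEmbedding.contMDiff.comp contMDiff_snd).contMDiffOn
  · intro s _ y _
    exact ⟨fun v ↦ 𝒟.isFutureUnitNormal.1.1 y v, 𝒟.isFutureUnitNormal.1.2 y,
      𝒟.isFutureUnitNormal.2 y⟩
  · intro y _ v w
    refine ⟨?_, ?_⟩
    · apply hasDerivAt_const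
    · apply hasDerivAt_const

/-- **Zero detectors are excluded by the non-gauge hypothesis** of fact (b) (and of
`AreDetectorsAt`): the combination with coefficient `1` of the single detector `(0, 0)` is the zero
pair, a local slice tangent (`isLocalSliceTangentAt_zero`). Together with `chartPairing_zero_detectors`
this shows the obvious degenerate instance is not a counterexample to (b): the hypothesis has
content. [folklore] -/
theorem not_areDetectorsAt_zero : ∀ (X : Type) [TopologicalSpace X] [ChartedSpace E3 X] [IsManifold (𝓡 3) ∞ X] [T2Space X] [SecondCountableTopology X] [ConnectedSpace X] (D : InitialDataSet (𝓡 3) X) (𝒟 : VacuumCauchyDevelopment D) (x₀ : X), ¬ AreDetectorsAt 𝒟 x₀ (fun _ : Fin 1 ↦ (0 : BilinField X)) (fun _ : Fin 1 ↦ (0 : BilinField X)) := by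
  intro X _ _ _ _ _ _ D 𝒟 x₀ h
  have hng := h.2.2 (fun _ ↦ 1) (fun h0 ↦ one_ne_zero (congrFun h0 0))
  apply hng
  have hsum : (fun x : X ↦ ∑ j : Fin 1, (fun _ : Fin 1 ↦ (1 : ℝ)) j • (fun _ : Fin 1 ↦ (0 : BilinField X)) j x) =
      (0 : BilinField X) := by
    funext x
    simp
  rw [hsum]
  exact isLocalSliceTangentAt_zero X D 𝒟 x₀

/-! ## §4 Consistency with the landed reduction and with the refutation of the r1 text -/

/-- **Corrected Moncrief transversality from `Sig.stub_moncriefFacts`** (the r3 statement spelled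
verbatim: the conjunction of the universal closures of the two facts): for SYMMETRIC detectors at a
germ-KID-free point (the three conjuncts of `AreSymmDetectorsAt`, spelled) and every open `V ∋ x₀`, a
jointly smooth admissible family through `D` supported in a compact subset of `V ∩` chart source with
non-singular pairing matrix — the landed reduction `stub_moncriefTransversality_of_localDeformation`
fed with the two facts at `(𝒟, x₀)` (this is the skeleton's glue `moncriefTransversality_of_facts`). [cite: Wald1984GR, Appendix E.2] -/
theorem moncriefTransversality_of_moncriefFacts : ((∀ (X : Type) [TopologicalSpace X] [ChartedSpace E3 X] [IsManifold (𝓡 3) ∞ X] [T2Space X] [SecondCountableTopology X] [ConnectedSpace X] (D : InitialDataSet (𝓡 3) X) (𝒟 : VacuumCauchyDevelopment D) (x₀ : X), LocalConstraintDeformationAt 𝒟 x₀) ∧ ∀ (X : Type) [TopologicalSpace X] [ChartedSpace E3 X] [IsManifold (𝓡 3) ∞ X] [T2Space X] [SecondCountableTopology X] [ConnectedSpace X] (D : InitialDataSet (𝓡 3) X) (𝒟 : VacuumCauchyDevelopment D) (x₀ : X), LocalMoncriefDualityAt 𝒟 x₀) → ∀ (X : Type) [TopologicalSpace X] [ChartedSpace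 E3 X] [IsManifold (𝓡 3) ∞ X] [T2Space X] [SecondCountableTopology X] [ConnectedSpace X], ∀ D ∈ admissibleVacuumData X, ∀ (𝒟 : VacuumCauchyDevelopment D) (x₀ : X) (k : ℕ) (A B : Fin k → BilinField X), ((∀ j x (v w : TangentSpace (𝓡 3) x), A j x v w = A j x w v ∧ B j x v w = B j x w v) ∧ IsKIDFreeAt 𝒟 x₀ ∧ AreDetectorsAt 𝒟 x₀ A B) → ∀ V : Set X, IsOpen V → x₀ ∈ V → ∃ G : EuclideanSpace ℝ (Fin k) → InitialDataSet (𝓡 3) X, InitialDataSet.IsSmoothDataFamily k G ∧ G 0 = D ∧ (∀ c, G c ∈ admissibleVacuumData X) ∧ (∃ K : Set X, IsCompact K ∧ K ⊆ V ∧ K ⊆ (extChartAt (𝓡 3) x₀).source ∧ IsSupportedIn D G K) ∧ (pairingMatrix D x₀ A B G).det ≠ 0 :=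
  fun hM X _ _ _ _ _ _ D hD 𝒟 x₀ k A B hdet V hV hxV ↦
    stub_moncriefTransversality_of_localDeformation X D hD 𝒟 x₀ k A B hdet.2.2 hdet.1 hdet.2.1
      (hM.1 X D 𝒟 x₀) (hM.2 X D 𝒟 x₀) V hV hxV

/-- **The facts cannot re-derive the refuted r1 text.** If ONE admissible datum has ONE vacuum
Cauchy development with ONE point satisfying `HasNoLocalKillingFieldNear` (the generic situation),
then any derivation of the r1 statement `Sig.stub_moncriefTransversality` (arbitrary, possibly
antisymmetric detectors; quoted verbatim, not asserted) from `Sig.stub_moncriefFacts` (spelled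
verbatim) REFUTES the facts — by `moncriefTransversality_false_of_kidFreePoint` (p104819). Since both
facts are theorems on paper, no such derivation exists: the r3 pair feeds only the corrected
(symmetric, germ-KID-free) transversality. [folklore] -/
theorem moncriefFacts_false_of_imp_r1 : (∃ (X : Type) (_ : TopologicalSpace X) (_ : ChartedSpace E3 X) (_ : IsManifold (𝓡 3) ∞ X) (_ : T2Space X) (_ : SecondCountableTopology X) (_ : ConnectedSpace X) (D : InitialDataSet (𝓡 3) X) (_ : D ∈ admissibleVacuumData X) (𝒟 : VacuumCauchyDevelopment D) (x₀ : X), HasNoLocalKillingFieldNear 𝒟 x₀) → (((∀ (X : Type) [TopologicalSpace X] [ChartedSpace E3 X] [IsManifold (𝓡 3) ∞ X] [T2Space X] [SecondCountableTopology X] [ConnectedSpace X] (D : InitialDataSet (𝓡 3) X) (𝒟 : VacuumCauchyDevelopment D) (x₀ : X), LocalConstraintDeformationAt 𝒟 x₀) ∧ ∀ (X : Type) [TopologicalSpace X] [ChartedSpace E3 X] [IsManifold (𝓡 3) ∞ X] [T2Space X] [SecondCountableTopology X] [ConnectedSpace X] (D : InitialDataSet (𝓡 3) X) (𝒟 : VacuumCauchyDevelopment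 D) (x₀ : X), LocalMoncriefDualityAt 𝒟 x₀) → ∀ (X : Type) [TopologicalSpace X] [ChartedSpace E3 X] [IsManifold (𝓡 3) ∞ X] [T2Space X] [SecondCountableTopology X] [ConnectedSpace X], ∀ D ∈ admissibleVacuumData X, ∀ (𝒟 : VacuumCauchyDevelopment D) (x₀ : X) (k : ℕ) (A B : Fin k → BilinField X), AreDetectorsAt 𝒟 x₀ A B → ∀ V : Set X, IsOpen V → x₀ ∈ V → ∃ G : EuclideanSpace ℝ (Fin k) → InitialDataSet (𝓡 3) X, InitialDataSet.IsSmoothDataFamily k G ∧ G 0 = D ∧ (∀ c, G c ∈ admissibleVacuumData X) ∧ (∃ K : Set X, IsCompact K ∧ K ⊆ V ∧ K ⊆ (extChartAt (𝓡 3) x₀).source ∧ IsSupportedIn D G K) ∧ (pairingMatrix D x₀ A B G).det ≠ 0) → ¬ ((∀ (X : Type) [TopologicalSpace X] [ChartedSpace E3 X] [IsManifold (𝓡 3) ∞ X] [T2Space X] [SecondCountableTopology X] [ConnectedSpace X] (D : InitialDataSet (𝓡 3) X) (𝒟 : VacuumCauchyDevelopment D) (x₀ : X), LocalConstraintDeformationAt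 𝒟 x₀) ∧ ∀ (X : Type) [TopologicalSpace X] [ChartedSpace E3 X] [IsManifold (𝓡 3) ∞ X] [T2Space X] [SecondCountableTopology X] [ConnectedSpace X] (D : InitialDataSet (𝓡 3) X) (𝒟 : VacuumCauchyDevelopment D) (x₀ : X), LocalMoncriefDualityAt 𝒟 x₀) :=
  fun hex himp hM ↦ moncriefTransversality_false_of_kidFreePoint hex (himp hM)

end Summit.FinalStateConjecture.FinalStateConjecture.Theorems.SymplecticDualOfTheBomb

end
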